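import Summits.CriticalPhenomena.PercolationContinuityZ3.Theorems.PercNearOneGluingNoHeavyQuantFarEarHairArithBoxA
import Summits.CriticalPhenomena.PercolationContinuityZ3.Theorems.PercNearOneGluingNoHeavyQuantFarEarHairArithBoxB
import Mathlib.Tactic.Ring
import Mathlib.Tactic.Positivity
import HarnessLib

/-!
# QUANT lane R8, front "FAR beyond trees", layer one — THE HAIRED EAR AT THE OBSERVER, VII: the regimes cover

builds on p205010 (kernel theorem, internal audit signed; external expert review pending)

Support file (`--supports stmt-CriticalPhenomena-4575`), seat `prim-quant-p1` (gen 27); memo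
`run/shared/lean/prim/quant/prim-quant-p1-g27/FOR-LEAD-HAIR.md` §3.  Pure real arithmetic; standard axioms; no sorries; no definitions.

The certificates of `…EarHairArith` are valid in regimes described by sign conditions on polynomials in the pair weights `p, r, s`, the
number `N` of outside relays and `g = P(o ~ u off Z)`.  This file proves the implications that make the decision tree of
`…EarHairArithMaster` exhaustive (notation `W = (1−p)(1−r)`, `Φ = 1 − s + sW`, `κ = (1−W)(1−rs) + W(1−r)`, `A₁ = Npκ − W(1−pr)`,
`A₂ = N((1−W)²(1−s) + W(1 − W(1−s))) − W`, `D = (N−1)Φ − N(1−s)W`):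
* `EarHair.cover_A2_of_A1` — `N ≥ 1`, `A₁ ≥ 0 ⟹ A₂ ≥ 0` (regime M0 is self-sufficient);
* `EarHair.cover_A2_of_D` — `N ≥ 2`, `D ≥ 0 ⟹ A₂ ≥ 0` (so `g = 1` falls in regime M4);
* `EarHair.cover_B_of_D` — `N ≥ 2`, `D < 0 ⟹` the five coefficients of M1 are `≥ 0`;
* `EarHair.cover_tau` — `N ≥ 2`, `A₁ < 0 ⟹` the `g = 0` values of the four M3 coefficients dominate `−A₁` (affine interpolation in `N`
  between `N = 2` and the root of `A₁`; box inequalities I2–I4b);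
* `EarHair.cover_Y` — `N ≥ 2`, `A₁ < 0`, not both `L₁, L₂ ≥ 0 ⟹` the four M3 coefficients are `≥ 0`;
* `EarHair.cover_Z` — `N = 1`, `A₁ < 0`, `L₁ < 0 ⟹` the three M3′ coefficients are `≥ 0`.
[this work].
-/

namespace Summit.CriticalPhenomena.PercolationContinuityZ3.Theorems

namespace Quant

namespace EarHair

/-- `A₁ ≥ 0 ⟹ A₂ ≥ 0` (`N ≥ 1`): regime M0 needs no further condition. [this work] -/
theorem cover_A2_of_A1 {p r s W N : ℝ} (hp0 : 0 ≤ p) (hp1 : p ≤ 1) (hr0 : 0 ≤ r) (hr1 : r ≤ 1) (hs0 : 0 ≤ s) (hs1 : s ≤ 1)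
    (hW : W = (1 - p) * (1 - r)) (hN : 1 ≤ N)
    (hA1 : 0 ≤ N * p * ((1 - W) * (1 - r * s) + W * (1 - r)) - W * (1 - p * r)) :
    0 ≤ N * ((1 - W) ^ 2 * (1 - s) + W * (1 - W * (1 - s))) - W := by
  have hW0 : 0 ≤ W := by rw [hW]; exact mul_nonneg (by linarith) (by linarith)
  have hW1 : W ≤ 1 := by rw [hW]; nlinarith
  have hX0 : 0 ≤ (1 - W) ^ 2 * (1 - s) + W * (1 - W * (1 - s)) :=
    add_nonneg (mul_nonneg (sq_nonneg _) (by linarith)) (mul_nonneg hW0 (by nlinarith))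
  have hNX : (1 - W) ^ 2 * (1 - s) + W * (1 - W * (1 - s)) ≤ N * ((1 - W) ^ 2 * (1 - s) + W * (1 - W * (1 - s))) :=
    le_mul_of_one_le_left hX0 hN
  by_cases hq : 0 ≤ 1 - 2 * W
  · -- `Q ≥ 1/2`: `X − W = (1−s)(1−2W) ≥ 0`
    have e : (1 - W) ^ 2 * (1 - s) + W * (1 - W * (1 - s)) - W = (1 - s) * (1 - 2 * W) := by ring
    have h1 : 0 ≤ (1 - s) * (1 - 2 * W) := mul_nonneg (by linarith) hq
    linarith
  · -- `Q < 1/2`: box inequality I1 (`(1−pr)·X ≥ pκ`) and the hypothesis `N p κ ≥ W(1−pr)`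
    have hq' : 0 ≤ 2 * ((1 - p) * (1 - r)) - 1 := by rw [← hW]; linarith
    have hI := box_I1 hp0 hp1 hr0 hr1 hs0 hs1 hq'
    rw [← hW] at hI
    have hpr : p * r < 1 := by nlinarith
    have hN0 : 0 ≤ N := by linarith
    have h1 : N * (p * ((1 - W) * (1 - r * s) + W * (1 - r))) ≤ N * ((1 - p * r) * ((1 - W) ^ 2 * (1 - s) + W * (1 - W * (1 - s)))) :=
      mul_le_mul_of_nonneg_left (by linarith) hN0
    have e : (1 - p * r) * (N * ((1 - W) ^ 2 * (1 - s) + W * (1 - W * (1 - s))) - W) =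
        N * ((1 - p * r) * ((1 - W) ^ 2 * (1 - s) + W * (1 - W * (1 - s)))) - W * (1 - p * r) := by ring
    have h2 : 0 ≤ (1 - p * r) * (N * ((1 - W) ^ 2 * (1 - s) + W * (1 - W * (1 - s))) - W) := by rw [e]; linarith
    exact (mul_nonneg_iff_of_pos_left (by linarith : (0:ℝ) < 1 - p * r)).1 h2

/-- `D ≥ 0 ⟹ N(1 − W(1−s)) ≥ 1` and `A₂ ≥ 0` (`N ≥ 2`). [this work] -/
theorem cover_A2_of_D {p r s W N : ℝ} (hp0 : 0 ≤ p) (hp1 : p ≤ 1) (hr0 : 0 ≤ r) (hr1 : r ≤ 1) (hs0 : 0 ≤ s) (hs1 : s ≤ 1)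
    (hW : W = (1 - p) * (1 - r)) (hN : 2 ≤ N)
    (hD : 0 ≤ (N - 1) * (1 - s + s * W) - N * (1 - s) * W) :
    1 ≤ N * (1 - W * (1 - s)) ∧ 0 ≤ N * ((1 - W) ^ 2 * (1 - s) + W * (1 - W * (1 - s))) - W := by
  have hW0 : 0 ≤ W := by rw [hW]; exact mul_nonneg (by linarith) (by linarith)
  have hW1 : W ≤ 1 := by rw [hW]; nlinarith
  have hPhi1 : 1 - s + s * W ≤ 1 := by nlinarith
  have h0 : (N - 1) * (1 - s + s * W) ≤ (N - 1) * 1 := mul_le_mul_of_nonneg_left hPhi1 (by linarith)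
  have h1 : 1 ≤ N * (1 - W * (1 - s)) := by nlinarith
  refine ⟨h1, ?_⟩
  have e : N * ((1 - W) ^ 2 * (1 - s) + W * (1 - W * (1 - s))) - W = N * (1 - W) ^ 2 * (1 - s) + W * (N * (1 - W * (1 - s)) - 1) := by
    ring
  rw [e]
  have t1 : 0 ≤ N * (1 - W) ^ 2 * (1 - s) := mul_nonneg (mul_nonneg (by linarith) (sq_nonneg _)) (by linarith)
  have t2 : 0 ≤ W * (N * (1 - W * (1 - s)) - 1) := mul_nonneg hW0 (by linarith)
  linarith

/-- `D < 0 ⟹` regime M1 is valid (`N ≥ 2`): `W + 1 − s > 0` and the five coefficients `B₁,…,B₅ ≥ 0`. [this work] -/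
theorem cover_B_of_D {p r s W N : ℝ} (hp0 : 0 ≤ p) (hp1 : p ≤ 1) (hr0 : 0 ≤ r) (hr1 : r ≤ 1) (hs0 : 0 ≤ s) (hs1 : s ≤ 1)
    (hW : W = (1 - p) * (1 - r)) (hN : 2 ≤ N)
    (hD : (N - 1) * (1 - s + s * W) - N * (1 - s) * W < 0) :
    0 < W + (1 - s) ∧
    0 ≤ (W + (1 - s)) * (p * r) * (1 - s) + s * W * (2 - p - s * (p * r) - p * r * N) ∧
    0 ≤ (W + (1 - s)) * p * (1 - r * s) + s * W * (1 + p * r - p - s * (p * r) - p * r * N) ∧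
    0 ≤ (W + (1 - s)) * (1 - p * r * s) - s * W * (N - 2 + p + s * (p * r)) ∧
    0 ≤ (W + (1 - s)) * (1 - s) * (1 - W) + s * W * (W - s) ∧
    0 ≤ (W + (1 - s)) * (1 - s + s * W) - N * s * W := by
  have hW0 : 0 ≤ W := by rw [hW]; exact mul_nonneg (by linarith) (by linarith)
  have hW1 : W ≤ 1 := by rw [hW]; nlinarith
  have hQp : p ≤ 1 - W := by rw [hW]; nlinarith
  have hpr : 0 ≤ p * r := mul_nonneg hp0 hr0
  have hprp : p * r ≤ p := by nlinarith
  have hsW : 0 ≤ s * W := mul_nonneg hs0 hW0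
  have hSW : 0 ≤ (1 - s) * W := mul_nonneg (by linarith) hW0
  have hPhi : 0 ≤ 1 - s + s * W := by nlinarith
  -- (f1) `s < 1` and `W > 0`
  have hS : 0 < 1 - s := by
    by_contra hc
    have hs' : s = 1 := le_antisymm hs1 (by linarith [le_of_not_gt hc])
    rw [hs'] at hD
    have : 0 ≤ (N - 1) * (1 - 1 + 1 * W) := mul_nonneg (by linarith) (by linarith)
    nlinarith
  have hWp : 0 < W := by
    by_contra hc
    have hw' : W = 0 := le_antisymm (le_of_not_gt hc) hW0
    rw [hw'] at hD
    have : 0 ≤ (N - 1) * (1 - s + s * 0) := mul_nonneg (by linarith) (by linarith)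
    nlinarith
  -- (f3) the rearranged hypothesis, (f2) `N(1−W) < 1`
  have f3 : (N - 1) * (s * W) < (1 - s) * (1 - N * (1 - W)) := by nlinarith
  have f2 : N * (1 - W) < 1 := by
    by_contra hc
    have hc' : 1 - N * (1 - W) ≤ 0 := by linarith [le_of_not_gt hc]
    have h1 : (1 - s) * (1 - N * (1 - W)) ≤ 0 := mul_nonpos_of_nonneg_of_nonpos hS.le hc'
    have h2 : 0 ≤ (N - 1) * (s * W) := mul_nonneg (by linarith) hsW
    linarith
  -- (f4) `s < 1/2 ≤ W`
  have f4 : s * W < (1 - s) * W := by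
    have h1 : (1 - s) * (1 - N * (1 - W)) ≤ (1 - s) * W := mul_le_mul_of_nonneg_left (by nlinarith) hS.le
    have h2 : s * W ≤ (N - 1) * (s * W) := le_mul_of_one_le_left hsW (by linarith)
    linarith
  have hs2 : s < 1 - s := lt_of_mul_lt_mul_right f4 hW0
  have hW2 : 1 / 2 ≤ W := by nlinarith
  have hsW' : s ≤ W := by linarith
  -- (f5) `N p r ≤ r`, `N p ≤ 1`
  have hNp : N * p ≤ 1 := by
    have h1 : N * p ≤ N * (1 - W) := mul_le_mul_of_nonneg_left hQp (by linarith)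
    linarith
  have f5 : p * r * N ≤ r := by nlinarith
  have hsp : s * (p * r) ≤ p * r := by nlinarith
  have hB5 : 0 ≤ (W + (1 - s)) * (1 - s + s * W) - N * s * W := by
    have e : (W + (1 - s)) * (1 - s + s * W) - (s * W) - (1 - s) = (1 - s + s * W) * (W - s) := by ring
    have h1 : 0 ≤ (1 - s + s * W) * (W - s) := mul_nonneg hPhi (by linarith)
    have h2 : 0 ≤ (1 - s) * (N * (1 - W)) := mul_nonneg hS.le (mul_nonneg (by linarith) (by linarith))
    have h3 : N * s * W = s * W + (N - 1) * (s * W) := by ring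
    nlinarith
  refine ⟨by linarith, ?_, ?_, ?_, ?_, hB5⟩
  · have h1 : 0 ≤ 2 - p - s * (p * r) - p * r * N := by nlinarith
    exact add_nonneg (mul_nonneg (mul_nonneg (by linarith) hpr) hS.le) (mul_nonneg hsW h1)
  · have h1 : 0 ≤ 1 + p * r - p - s * (p * r) - p * r * N := by
      have e : 1 + p * r - p - s * (p * r) - r = W - s * (p * r) := by rw [hW]; ring
      nlinarith
    exact add_nonneg (mul_nonneg (mul_nonneg (by linarith) hp0) (by nlinarith)) (mul_nonneg hsW h1)
  · -- `B₃ ≥ B₅ ≥ 0`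
    have e : (W + (1 - s)) * (1 - p * r * s) - s * W * (N - 2 + p + s * (p * r)) - ((W + (1 - s)) * (1 - s + s * W) - N * s * W) =
        (W + (1 - s)) * s * (1 - W - p * r) + s * W * (2 - p - s * (p * r)) := by ring
    have h1 : 0 ≤ (W + (1 - s)) * s * (1 - W - p * r) := mul_nonneg (mul_nonneg (by linarith) hs0) (by linarith)
    have h2 : 0 ≤ s * W * (2 - p - s * (p * r)) := mul_nonneg hsW (by nlinarith)
    linarith
  · exact add_nonneg (mul_nonneg (mul_nonneg (by linarith) hS.le) (by linarith)) (mul_nonneg hsW (by linarith))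

/-- **The `g = 0` values of the M3 coefficients dominate `−A₁`** (`N ≥ 2`, `A₁ < 0`): with `Ā = −A₁ = W(1−pr) − Npκ`,
`Φ(2−p−spr) − Np(1−rs) ≥ Ā`, `Φ(2−p−spr−prN) − Np(1−r) ≥ Ā`, `Φ(1+pr−p−spr−prN) ≥ Ā`, `N(1−p) − Φ(N−2+p+spr) ≥ Ā`. [this work] -/
theorem cover_tau {p r s W N : ℝ} (hp0 : 0 ≤ p) (hp1 : p ≤ 1) (hr0 : 0 ≤ r) (hr1 : r ≤ 1) (hs0 : 0 ≤ s) (hs1 : s ≤ 1)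
    (hW : W = (1 - p) * (1 - r)) (hN : 2 ≤ N)
    (hA1 : N * p * ((1 - W) * (1 - r * s) + W * (1 - r)) - W * (1 - p * r) < 0) :
    -(N * p * ((1 - W) * (1 - r * s) + W * (1 - r)) - W * (1 - p * r)) ≤ (1 - s + s * W) * (2 - p - s * (p * r)) - N * p * (1 - r * s) ∧
    -(N * p * ((1 - W) * (1 - r * s) + W * (1 - r)) - W * (1 - p * r)) ≤
      (1 - s + s * W) * (2 - p - s * (p * r) - p * r * N) - N * p * (1 - r) ∧
    -(N * p * ((1 - W) * (1 - r * s) + W * (1 - r)) - W * (1 - p * r)) ≤ (1 - s + s * W) * (1 + p * r - p - s * (p * r) - p * r * N) ∧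
    -(N * p * ((1 - W) * (1 - r * s) + W * (1 - r)) - W * (1 - p * r)) ≤ N * (1 - p) - (1 - s + s * W) * (N - 2 + p + s * (p * r)) := by
  have hW0 : 0 ≤ W := by rw [hW]; exact mul_nonneg (by linarith) (by linarith)
  have hW1 : W ≤ 1 := by rw [hW]; nlinarith
  have hrs : r * s ≤ 1 := by nlinarith
  have hrp : r * (1 - p) ≤ 1 := by nlinarith
  have hkap : 0 ≤ (1 - W) * (1 - r * s) + W * (1 - r) := add_nonneg (mul_nonneg (by linarith) (by linarith)) (mul_nonneg hW0 (by linarith))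
  have hpk : 0 ≤ p * ((1 - W) * (1 - r * s) + W * (1 - r)) := mul_nonneg hp0 hkap
  have hN2 : 0 ≤ N - 2 := by linarith
  have hb0 : 0 ≤ p * (1 - r) * (1 - r * (1 - p)) := mul_nonneg (mul_nonneg hp0 (by linarith)) (by linarith)
  have hI2 := box_I2 hp0 hp1 hr0 hr1 hs0 hs1
  have hI3b := box_I3b hp0 hp1 hr0 hr1 hs0 hs1
  have hI4a := box_I4a hp0 hp1 hr0 hr1 hs0 hs1
  have hI4b := box_I4b hp0 hp1 hr0 hr1 hs0 hs1
  rw [← hW] at hI2 hI3b hI4a hI4b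
  -- `Ā(2) ≥ Ā(N) > 0`
  have hA2N : W * (1 - p * r) - N * (p * ((1 - W) * (1 - r * s) + W * (1 - r))) ≤
      W * (1 - p * r) - 2 * (p * ((1 - W) * (1 - r * s) + W * (1 - r))) := by
    have := mul_nonneg hN2 hpk; linarith
  have hAbN : 0 < W * (1 - p * r) - N * (p * ((1 - W) * (1 - r * s) + W * (1 - r))) := by linarith
  have hAb2 : 0 < W * (1 - p * r) - 2 * p * ((1 - W) * (1 - r * s) + W * (1 - r)) := by linarith
  have hI3a := box_I3a hp0 hp1 hr0 hr1 hs0 hs1 (by rw [← hW]; exact hAb2.le)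
  rw [← hW] at hI3a
  -- k = 01 by interpolation: `Ā(2)·τ₀₁(N) = Ā(N)·τ₀₁(2) + (N−2)·p·G₀₁`
  have key01 : (W * (1 - p * r) - 2 * p * ((1 - W) * (1 - r * s) + W * (1 - r))) *
      ((1 - s + s * W) * (2 - p - s * (p * r) - p * r * N) - N * p * (1 - r) +
        (N * p * ((1 - W) * (1 - r * s) + W * (1 - r)) - W * (1 - p * r))) =
    (W * (1 - p * r) - N * (p * ((1 - W) * (1 - r * s) + W * (1 - r)))) *
      (((1 - s + s * W) * (2 - p - s * (p * r)) - W * (1 - p * r)) - 2 * (p * r) * W) +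
    (N - 2) * (p * (((1 - W) * (1 - r * s) + W * (1 - r)) * ((1 - s + s * W) * (2 - p - s * (p * r)) - W * (1 - p * r)) -
      r * W * W * (1 - p * r))) := by ring
  have t01a : 0 ≤ (W * (1 - p * r) - N * (p * ((1 - W) * (1 - r * s) + W * (1 - r)))) *
      (((1 - s + s * W) * (2 - p - s * (p * r)) - W * (1 - p * r)) - 2 * (p * r) * W) := mul_nonneg hAbN.le hI3a
  have t01b : 0 ≤ (N - 2) * (p * (((1 - W) * (1 - r * s) + W * (1 - r)) * ((1 - s + s * W) * (2 - p - s * (p * r)) - W * (1 - p * r)) -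
      r * W * W * (1 - p * r))) := mul_nonneg hN2 (mul_nonneg hp0 hI3b)
  have h01 : 0 ≤ (1 - s + s * W) * (2 - p - s * (p * r) - p * r * N) - N * p * (1 - r) +
      (N * p * ((1 - W) * (1 - r * s) + W * (1 - r)) - W * (1 - p * r)) :=
    (mul_nonneg_iff_of_pos_left hAb2).1 (by rw [key01]; linarith)
  refine ⟨?_, by linarith, ?_, ?_⟩
  · -- k = 00: `τ₀₀ = τ₀₁ + N p r s W`
    have hex : 0 ≤ N * (p * r) * s * W := mul_nonneg (mul_nonneg (mul_nonneg (by linarith) (mul_nonneg hp0 hr0)) hs0) hW0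
    have e : (1 - s + s * W) * (2 - p - s * (p * r)) - N * p * (1 - r * s) =
        ((1 - s + s * W) * (2 - p - s * (p * r) - p * r * N) - N * p * (1 - r)) + N * (p * r) * s * W := by ring
    rw [e]; linarith
  · -- k = a₁: the `N`-coefficient `p(1 − r − Wr) = p(1−r)(1 − r(1−p)) ≥ 0`, so `N = 2` (box I2) is the worst case
    have hb : p * (1 - r - W * r) = p * (1 - r) * (1 - r * (1 - p)) := by rw [hW]; ring
    have key : (1 - s + s * W) * (1 + p * r - p - s * (p * r) - p * r * N) +
        (N * p * ((1 - W) * (1 - r * s) + W * (1 - r)) - W * (1 - p * r)) =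
      (2 * (p * (1 - r - W * r)) + (1 - s + s * W) * ((1 - p) + (p * r) * (1 - s)) - W * (1 - p * r)) +
        (N - 2) * (p * (1 - r - W * r)) := by ring
    rw [hb] at key
    have t2 : 0 ≤ (N - 2) * (p * (1 - r) * (1 - r * (1 - p))) := mul_nonneg hN2 hb0
    have e2 : 2 * (p * (1 - r) * (1 - r * (1 - p))) = 2 * p * (1 - r) * (1 - r * (1 - p)) := by ring
    linarith
  · -- k = a₂ by interpolation: `Ā(2)·τ_{a₂}(N) = Ā(N)·τ_{a₂}(2) + (N−2)·E_{a₂}`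
    have key : (W * (1 - p * r) - 2 * p * ((1 - W) * (1 - r * s) + W * (1 - r))) *
        (N * (1 - p) - (1 - s + s * W) * (N - 2 + p + s * (p * r)) +
          (N * p * ((1 - W) * (1 - r * s) + W * (1 - r)) - W * (1 - p * r))) =
      (W * (1 - p * r) - N * (p * ((1 - W) * (1 - r * s) + W * (1 - r)))) *
        (2 * ((1 - p) - (1 - s + s * W) + p * ((1 - W) * (1 - r * s) + W * (1 - r))) +
          ((1 - s + s * W) * (2 - p - s * (p * r)) - W * (1 - p * r))) +
      (N - 2) * (p * ((1 - W) * (1 - r * s) + W * (1 - r)) * ((1 - s + s * W) * (2 - p - s * (p * r)) - W * (1 - p * r)) +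
        ((1 - p) - (1 - s + s * W) + p * ((1 - W) * (1 - r * s) + W * (1 - r))) * W * (1 - p * r)) := by ring
    have t1 : 0 ≤ (W * (1 - p * r) - N * (p * ((1 - W) * (1 - r * s) + W * (1 - r)))) *
        (2 * ((1 - p) - (1 - s + s * W) + p * ((1 - W) * (1 - r * s) + W * (1 - r))) +
          ((1 - s + s * W) * (2 - p - s * (p * r)) - W * (1 - p * r))) := mul_nonneg hAbN.le hI4a
    have t2 : 0 ≤ (N - 2) * (p * ((1 - W) * (1 - r * s) + W * (1 - r)) * ((1 - s + s * W) * (2 - p - s * (p * r)) - W * (1 - p * r)) +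
        ((1 - p) - (1 - s + s * W) + p * ((1 - W) * (1 - r * s) + W * (1 - r))) * W * (1 - p * r)) := mul_nonneg hN2 hI4b
    have h := (mul_nonneg_iff_of_pos_left hAb2).1 (by rw [key]; linarith)
    linarith

/-- **Regime M3 is valid on branch 4** (`N ≥ 2`, `A₁ < 0`, not both `L₁ ≥ 0` and `L₂ ≥ 0`): the four coefficients of `…arith_M3` are
nonnegative. [this work] -/
theorem cover_Y {p r s W N g : ℝ} (hp0 : 0 ≤ p) (hp1 : p ≤ 1) (hr0 : 0 ≤ r) (hr1 : r ≤ 1) (hs0 : 0 ≤ s) (hs1 : s ≤ 1)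
    (hW : W = (1 - p) * (1 - r)) (hN : 2 ≤ N) (hg0 : 0 ≤ g) (hg1 : g ≤ 1)
    (hA1 : N * p * ((1 - W) * (1 - r * s) + W * (1 - r)) - W * (1 - p * r) < 0)
    (hL : g * (N * ((1 - W) ^ 2 * (1 - s) + W * (1 - W * (1 - s))) - W) +
        (N * p * ((1 - W) * (1 - r * s) + W * (1 - r)) - W * (1 - p * r)) * (1 - g) < 0 ∨
      N * g * (1 - W) * (1 - s) + (N * p * ((1 - W) * (1 - r * s) + W * (1 - r)) - W * (1 - p * r)) * (1 - g) < 0) :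
    0 ≤ (1 - g) * ((1 - s + s * W) * (2 - p - s * (p * r)) - N * p * (1 - r * s)) +
      g * ((1 - s + s * W) * (W + (1 - s)) - N * (1 - s) * (1 - W)) ∧
    0 ≤ (1 - g) * ((1 - s + s * W) * (2 - p - s * (p * r) - p * r * N) - N * p * (1 - r)) +
      g * ((1 - s + s * W) * (W + (1 - s)) - N * (1 - s) * (1 - W)) ∧
    0 ≤ (1 - g) * (1 - s + s * W) * (1 + p * r - p - s * (p * r) - p * r * N) +
      g * ((1 - s + s * W) * (W + (1 - s)) - N * (1 - s) * (1 - W)) ∧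
    0 ≤ (1 - g) * (N * (1 - p) - (1 - s + s * W) * (N - 2 + p + s * (p * r))) +
      g * ((1 - s + s * W) * (W + (1 - s)) - N * (1 - s) * (1 - W)) := by
  have hW0 : 0 ≤ W := by rw [hW]; exact mul_nonneg (by linarith) (by linarith)
  have hW1 : W ≤ 1 := by rw [hW]; nlinarith
  have hPhi : 0 ≤ 1 - s + s * W := by nlinarith
  have hNs : 1 - N * s ≤ 1 - s := by
    have := mul_nonneg (show (0:ℝ) ≤ N - 1 by linarith) hs0; linarith
  obtain ⟨τ00, τ01, τA1, τA2⟩ := cover_tau hp0 hp1 hr0 hr1 hs0 hs1 hW hN hA1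
  have hI7a := box_I7a hp0 hp1 hr0 hr1 hs0 hs1
  rw [← hW] at hI7a
  have hPL : 0 ≤ g * ((1 - s + s * W) * (W + (1 - s))) := mul_nonneg hg0 (mul_nonneg hPhi (by linarith))
  have hg' : 0 ≤ 1 - g := by linarith
  -- the core inequality `(1−g)Ā + g K̃ ≥ 0`
  have core : 0 ≤ (1 - g) * (-(N * p * ((1 - W) * (1 - r * s) + W * (1 - r)) - W * (1 - p * r))) +
      g * ((1 - s + s * W) * (W + (1 - s)) - N * (1 - s) * (1 - W)) := by
    rcases hL with h | h
    · -- `L₁ < 0`: `g A₂ < Ā(1−g)` with `A₂ = N(1−W)(1−s) + W(Ns−1)` and `W(1−Ns) ≤ W(1−s) ≤ ΦΛ`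
      have e : N * ((1 - W) ^ 2 * (1 - s) + W * (1 - W * (1 - s))) - W = N * (1 - W) * (1 - s) + W * (N * s - 1) := by ring
      rw [e] at h
      have h2 : W * (1 - N * s) ≤ W * (1 - s) := mul_le_mul_of_nonneg_left hNs hW0
      have h3 : g * (W * (1 - N * s)) ≤ g * ((1 - s + s * W) * (W + (1 - s))) := mul_le_mul_of_nonneg_left (by linarith) hg0
      linarith
    · linarith
  refine ⟨?_, ?_, ?_, ?_⟩
  · have := mul_le_mul_of_nonneg_left τ00 hg'; linarith
  · have := mul_le_mul_of_nonneg_left τ01 hg'; linarith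
  · have := mul_le_mul_of_nonneg_left τA1 hg'
    have e : (1 - g) * (1 - s + s * W) * (1 + p * r - p - s * (p * r) - p * r * N) =
        (1 - g) * ((1 - s + s * W) * (1 + p * r - p - s * (p * r) - p * r * N)) := by ring
    rw [e]; linarith
  · have := mul_le_mul_of_nonneg_left τA2 hg'; linarith

/-- **Regime M3′ is valid on branch 3 of the one-outside-relay tree** (`N = 1`, `A₁ < 0`, `L₁ < 0`): the three coefficients of
`…arith_M3one` are nonnegative. [this work] -/
theorem cover_Z {p r s W g : ℝ} (hp0 : 0 ≤ p) (hp1 : p ≤ 1) (hr0 : 0 ≤ r) (hr1 : r ≤ 1) (hs0 : 0 ≤ s) (hs1 : s ≤ 1)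
    (hW : W = (1 - p) * (1 - r)) (hg0 : 0 ≤ g) (hg1 : g ≤ 1)
    (hA1 : 1 * p * ((1 - W) * (1 - r * s) + W * (1 - r)) - W * (1 - p * r) < 0)
    (hL1 : g * (1 * ((1 - W) ^ 2 * (1 - s) + W * (1 - W * (1 - s))) - W) +
      (1 * p * ((1 - W) * (1 - r * s) + W * (1 - r)) - W * (1 - p * r)) * (1 - g) < 0) :
    0 ≤ (1 - g) * (-(p * (1 - r * s)) + ((1 - s) * (1 - W) + s * W) * (2 - p - s * (p * r))) +
      g * (((1 - s) * (1 - W) + s * W) * (W + (1 - s)) - (1 - s) * (1 - W)) ∧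
    0 ≤ (1 - g) * (-(p * (1 - r)) + ((1 - s) * (1 - W) + s * W) * (2 - p - s * (p * r) - p * r)) +
      g * (((1 - s) * (1 - W) + s * W) * (W + (1 - s)) - (1 - s) * (1 - W)) ∧
    0 ≤ (1 - g) * ((1 - s) * (1 - W) + s * W) * (1 - p - s * (p * r)) +
      g * (((1 - s) * (1 - W) + s * W) * (W + (1 - s)) - (1 - s) * (1 - W)) := by
  have hAb' : 0 ≤ ((1 - p) * (1 - r)) * (1 - p * r) - p * ((1 - (1 - p) * (1 - r)) * (1 - r * s) + ((1 - p) * (1 - r)) * (1 - r)) := by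
    rw [← hW]; linarith
  have e2 : 1 * ((1 - W) ^ 2 * (1 - s) + W * (1 - W * (1 - s))) - W = (1 - s) * (2 * (1 - W) - 1) := by ring
  rw [e2] at hL1
  have hg' : 0 ≤ 1 - g := by linarith
  have e3 : (1 - g) * ((1 - s) * (1 - W) + s * W) * (1 - p - s * (p * r)) =
      (1 - g) * (((1 - s) * (1 - W) + s * W) * (1 - p - s * (p * r))) := by ring
  rw [e3]
  by_cases hq : 0 ≤ 2 * (1 - W) - 1
  · -- `Q ≥ 1/2`: `Z⁰ ≥ Ā`, `−K₁ ≤ (1−s)(2Q−1)`, and `g(1−s)(2Q−1) < Ā(1−g)`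
    have hq' : 0 ≤ 2 * (1 - (1 - p) * (1 - r)) - 1 := by rw [← hW]; exact hq
    have z00 := box_I5a00 hp0 hp1 hr0 hr1 hs0 hs1 hq' hAb'
    have z01 := box_I5a01 hp0 hp1 hr0 hr1 hs0 hs1 hq' hAb'
    have zA1 := box_I5aA1 hp0 hp1 hr0 hr1 hs0 hs1 hq' hAb'
    have hK := box_I7c hp0 hp1 hr0 hr1 hs0 hs1 hq'
    rw [← hW] at z00 z01 zA1 hK
    have h1 : g * (-((((1 - s) * (1 - W) + s * W) * (W + (1 - s))) - (1 - s) * (1 - W))) ≤ g * ((1 - s) * (2 * (1 - W) - 1)) :=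
      mul_le_mul_of_nonneg_left (by linarith) hg0
    have core : 0 ≤ (1 - g) * (W * (1 - p * r) - p * ((1 - W) * (1 - r * s) + W * (1 - r))) +
        g * ((((1 - s) * (1 - W) + s * W) * (W + (1 - s))) - (1 - s) * (1 - W)) := by linarith
    have m00 := mul_nonneg hg' z00
    have m01 := mul_nonneg hg' z01
    have mA1 := mul_nonneg hg' zA1
    exact ⟨by linarith, by linarith, by linarith⟩
  · -- `Q < 1/2`: `Z⁰ ≥ 0` and `K₁ ≥ 0`
    have hq' : 0 ≤ 2 * ((1 - p) * (1 - r)) - 1 := by rw [← hW]; linarith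
    have z00 := box_I5b00 hp0 hp1 hr0 hr1 hs0 hs1 hq' hAb'
    have z01 := box_I5b01 hp0 hp1 hr0 hr1 hs0 hs1 hq' hAb'
    have zA1 := box_I5bA1 hp0 hp1 hr0 hr1 hs0 hs1 hq' hAb'
    have hK := box_I7b hp0 hp1 hr0 hr1 hs0 hs1 hq'
    rw [← hW] at z00 z01 zA1 hK
    have hgK := mul_nonneg hg0 hK
    have m00 := mul_nonneg hg' z00
    have m01 := mul_nonneg hg' z01
    have mA1 := mul_nonneg hg' zA1
    exact ⟨by linarith, by linarith, by linarith⟩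

end EarHair

end Quant

end Summit.CriticalPhenomena.PercolationContinuityZ3.Theorems
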